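import Summits.KontsevichZagierPeriods.Zeta5Search.WellPoisedInteriorOddPhiRateCert
import Summits.KontsevichZagierPeriods.Zeta5Search.WellPoisedInteriorNoGo
import HarnessLib.Audit
import HarnessLib

/-!
# The `Φ`-rate (8.10) in the interior, UNIFORMLY: the CANONICAL certificate of EVERY integral direction passes
# the checker (a structural theorem, no per-direction `decide`) — cell `pub-zeta5`, class `vwp` (gen 83),
# SCOREBOARD §D "no-go theorem" (the interior upgrade); generic in `q = M + 5`, so class `odd` inherits it

HONEST FRAMING: systematic search; no irrationality claim unless certified.  The tree's `Φ`-rate machinery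
(`WellPoisedInteriorOddPhiRate{,Cert}`, fam-odd g65: `PhiPiece.check`, `IntDir.certCheck`, `log_intPhi_eventually_le`,
`interior_noGo_cert`) discharges hypothesis `(ii)` of the interior no-go at a direction CARRYING A CHECKED
CERTIFICATE, and certificates were so far supplied direction by direction as `decide +kernel` data (`…Argmax9/11`,
`…Argmax7`).
THIS FILE removes the per-direction step: for EVERY `E : IntDir M` and every `K, N₀ ≥ 1` it DEFINES a certificate
`E.canonCert K N₀` — the `y`-UNIFORM partition of `[1/μ, N₀)` into the pieces `x ∈ [W/(i+1), W/i)`, `W = K N₀`,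
`i = K, …, Wμ − 1`, each with the witness slope `c_i :=` the arg-min of the endpoint bound `U_c` over the tail-type
slopes `{η_j, η₀ − η_j}` (always in range, `m = 0`) and, where `(η₀ − 2η₄)·W ≥ i + 1`, over all of `0, …, η₀`; bound
`g_i := max(0, U_{c_i})`, weight `g_i/W` — and PROVES `E.certCheck (E.canonCert K N₀) = true` STRUCTURALLY
(`canon_certCheck`: positivity, admissibility by construction, `U ≤ g` by `Int.self_le_toNat`, the weight identity
`g·(1/a − 1/b) = g/W`, and the chain `W/(Wμ) = 1/μ → … → W/K = N₀` by induction).  Hence for every direction, with the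
COMPUTABLE natural number `canonSub E K N₀ = Σ_i g_i` (`IntDir.canonSub`):

* `log_intPhi_eventually_le_canon`: `∀ ε > 0, ∀ᶠ n, log Φ(h_n) ≤ ((M+8)/N₀ + canonSub/(K N₀) + ε)·n`;
* `interior_noGo_canon`: `C₀ + (M+8)/N₀ + canonSub/(K N₀) < δ` + Lemma 20's floor `(i)` ⟹ `Λ_n ↛ 0`
  (+ the growth form `interior_frequently_exp_le_canon`);
* the `q = 7` (`ζ(5)`-only, class `vwp`) dictionary over the eight-argument `genPhi / genF / genLambda / genDelta` of
  `WellPoisedInteriorForms/NoGo` (fam-vwp, p319648/p320298): `dir7`, `canon_phiRate7`, `interior_noGo_canon7` — the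
  interior no-go at EVERY admissible `(η₀; η₁,η₂,η₃ | η₄,…,η₇)` with the `Φ`-rate DISCHARGED, the only printed input
  left being Lemma 20's `C₀` ([Zudilin2004, Lemma 20]) in the inequality `C₀ < genDelta − 10/N₀ − canonSub/(K N₀)`;
* kernel cross-checks of the functional at the two `κ`-arg-max directions of the lane record (SUPKAPPA7.md §1):
  `canonSub (30;1,1,1|8,9,10,11) 8 2 = 431`, `canonSub (24;1,1,1|6,7,8,9) 1 1 = 78` (`decide`), values the two
  exact-integer mirrors of the g83 folder (`canon.py` = `canon7.c`, equal row for row) reproduce while tabulating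
  `canonSub(E; 8, 2)` over the whole exhausted box `8 ≤ η₀ ≤ 30` (285,684 directions, all with
  `10/2 + canonSub/16 < (1 − κ_max(η₀,η₁))·genDelta`; table in the g83 README — MODEL side: `κ`, `C₀` are Lemma 20's).

What is NOT proved here: Lemma 20 (hypothesis `(i)`); any value of `C₀`; any equality `φ̄ = φ` (the canonical bound
at `(K, N₀) = (8, 2)` exceeds Zudilin's `φ` by `(M+8)/N₀` plus the partition loss; it DEcreases to the offset-free
optimum as `K, N₀ → ∞`).  NEGATIVE-shaped; standard axioms; no Literature fact, no `@[conjecture]`, complete proofs.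
-/

noncomputable section

open Real Finset Filter Topology

namespace Summit.KontsevichZagierPeriods.Zeta5Search

namespace WellPoisedFace

/-! ### 1. The canonical piece `x ∈ [W/(i+1), W/i)` -/

namespace PhiPiece

/-- The CANONICAL piece `x ∈ [W/(i+1), W/i)` with witness slope `c`, bound `g` and weight `ub = g` (scale `D = W`:
`g·(1/a − 1/b) = g·((i+1) − i)/W = g/W`). -/
def canon (W i : ℕ) (c : ℤ) (g : ℕ) : PhiPiece := ⟨W, i + 1, W, i, c, g, g⟩

/-- `U` of a canonical piece does not depend on the bound fields. -/
theorem canon_U (W i : ℕ) (c : ℤ) (g : ℕ) (η₀ : ℕ) (heads tails : List ℕ) :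
    (canon W i c g).U η₀ heads tails = (canon W i c 0).U η₀ heads tails := rfl

/-- A canonical piece with `W, i ≥ 1`, an admissible witness and `U ≤ g` passes the checker at scale `D = W`. -/
theorem canon_check {W i : ℕ} (hW : 0 < W) (hi : 0 < i) {c : ℤ} {g : ℕ} {η₀ a4 : ℕ} {heads tails : List ℕ}
    (hadm : (canon W i c g).adm η₀ a4 tails = true) (hU : (canon W i c g).U η₀ heads tails ≤ g) :
    (canon W i c g).check η₀ a4 heads tails W = true := by
  have hU' : (canon W i c g).U η₀ heads tails ≤ ((canon W i c g).g : ℤ) := hU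
  simp only [check, hadm, Bool.and_true, Bool.and_eq_true, decide_eq_true_eq]
  refine ⟨⟨⟨⟨⟨hW, Nat.succ_pos i⟩, hi⟩, ?_⟩, hU'⟩, ?_⟩
  · show W * i < W * (i + 1)
    nlinarith
  · show W * g * ((i + 1) * W) ≤ g * (W * W) + W * g * (i * W)
    nlinarith

/-- The left endpoint of a canonical piece: `a = W/(i+1)`. -/
theorem canon_a (W i : ℕ) (c : ℤ) (g : ℕ) : (canon W i c g).a = (W : ℚ) / ((i + 1 : ℕ) : ℚ) := rfl

/-- The right endpoint of a canonical piece: `b = W/i`. -/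
theorem canon_b (W i : ℕ) (c : ℤ) (g : ℕ) : (canon W i c g).b = (W : ℚ) / (i : ℚ) := rfl

end PhiPiece

/-! ### 2. The canonical certificate of a direction and its structural check -/

namespace IntDir

variable {M : ℕ} (E : IntDir M)

/-- The TAIL-TYPE slopes `η_j, η₀ − η_j` (`j = 4, …, q`): witnesses in the range of (8.9) with `m = 0`, always. -/
def tailSlopes : List ℤ := (List.ofFn E.tail).flatMap fun b : ℕ => [(b : ℤ), (E.η₀ : ℤ) - b]

/-- The candidate witnesses on the canonical piece `i` at width `W`: the tail-type slopes, and every slope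
`0, …, η₀` where the piece is deep enough (`(η₀ − 2η₄)·a ≥ 1`, i.e. `i + 1 ≤ (η₀ − 2η₄)·W`). -/
def canonCands (W i : ℕ) : List ℤ :=
  if i + 1 ≤ (E.η₀ - 2 * E.a) * W then E.tailSlopes ++ (List.range (E.η₀ + 1)).map (fun k : ℕ => (k : ℤ))
  else E.tailSlopes

/-- `U_c` on the canonical piece `i` (the endpoint bound of `F_c` on `[W/(i+1), W/i)`). -/
def canonU (W i : ℕ) (c : ℤ) : ℤ := (PhiPiece.canon W i c 0).U E.η₀ (List.ofFn E.head) (List.ofFn E.tail)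

/-- The chosen witness: the arg-min of `U_c` over the candidates (first minimiser; default `η₄`, never used). -/
def canonC (W i : ℕ) : ℤ := ((E.canonCands W i).argmin (E.canonU W i)).getD (E.a : ℤ)

/-- The bound `g_i = max(0, U_{c_i})`. -/
def canonG (W i : ℕ) : ℕ := (E.canonU W i (E.canonC W i)).toNat

/-- The canonical piece `i` of the direction. -/
def canonPiece (W i : ℕ) : PhiPiece := PhiPiece.canon W i (E.canonC W i) (E.canonG W i)

/-- The pieces `i = K + m − 1, …, K + 1, K`, left to right in `x` (`x ∈ [W/(K+m), W/K)`). -/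
def canonList (W K : ℕ) : ℕ → List PhiPiece
  | 0 => []
  | m + 1 => E.canonPiece W (K + m) :: canonList W K m

/-- THE CANONICAL CERTIFICATE at `(K, N₀)`: `W = D = K N₀`, pieces `i = Wμ − 1, …, K` covering `[1/μ, N₀)`. -/
def canonCert (K N₀ : ℕ) : PhiCert := ⟨N₀, K * N₀, E.canonList (K * N₀) K (K * N₀ * E.imu E.d - K)⟩

/-- `canonSub E K N₀ = Σ_i g_i`, the `W`-scaled weight of the canonical certificate (a computable natural number). -/
def canonSub (K N₀ : ℕ) : ℕ := (E.canonCert K N₀).Sub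

/-- Where the chosen witness comes from: a candidate, or (vacuously, on an empty candidate list) `η₄`. -/
theorem canonC_mem_or (W i : ℕ) : E.canonC W i ∈ E.canonCands W i ∨ E.canonC W i = (E.a : ℤ) := by
  unfold canonC
  cases h : (E.canonCands W i).argmin (E.canonU W i) with
  | none => exact Or.inr (by simp)
  | some m => exact Or.inl (by simpa using List.argmin_mem (Option.mem_def.2 h))

/-- A tail-type slope is admissible (the `any` disjunct of `PhiPiece.adm`). -/
theorem any_of_mem_tailSlopes {c : ℤ} (hc : c ∈ E.tailSlopes) :
    (List.ofFn E.tail).any (fun b : ℕ => c == (b : ℤ) || c == (E.η₀ : ℤ) - b) = true := by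
  unfold tailSlopes at hc
  rw [List.mem_flatMap] at hc
  obtain ⟨b, hb, hcb⟩ := hc
  rw [List.any_eq_true]
  refine ⟨b, hb, ?_⟩
  simp only [List.mem_cons, List.not_mem_nil, or_false] at hcb
  rcases hcb with h | h <;> simp [h]

/-- **The canonical witness is admissible** on its piece. -/
theorem canonPiece_adm (W i : ℕ) : (E.canonPiece W i).adm E.η₀ E.a (List.ofFn E.tail) = true := by
  unfold PhiPiece.adm
  show ((List.ofFn E.tail).any (fun b : ℕ => E.canonC W i == (b : ℤ) || E.canonC W i == (E.η₀ : ℤ) - b)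
    || decide (i + 1 ≤ (E.η₀ - 2 * E.a) * W)) = true
  rw [Bool.or_eq_true]
  rcases E.canonC_mem_or W i with h | h
  · unfold canonCands at h
    by_cases hdeep : i + 1 ≤ (E.η₀ - 2 * E.a) * W
    · exact Or.inr (decide_eq_true hdeep)
    · rw [if_neg hdeep] at h
      exact Or.inl (E.any_of_mem_tailSlopes h)
  · refine Or.inl ?_
    rw [List.any_eq_true]
    refine ⟨E.a, ?_, by simp [h]⟩
    rw [List.mem_ofFn]
    exact ⟨0, rfl⟩

/-- **Every canonical piece with `W, i ≥ 1` passes the checker** at scale `D = W`. -/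
theorem canonPiece_check {W i : ℕ} (hW : 0 < W) (hi : 0 < i) :
    (E.canonPiece W i).check E.η₀ E.a (List.ofFn E.head) (List.ofFn E.tail) W = true := by
  refine PhiPiece.canon_check hW hi (E.canonPiece_adm W i) ?_
  rw [PhiPiece.canon_U]
  exact Int.self_le_toNat _

/-- The members of `canonList W K m` are the canonical pieces `K + j`, `j < m`. -/
theorem mem_canonList {W K : ℕ} :
    ∀ {m : ℕ} {P : PhiPiece}, P ∈ E.canonList W K m → ∃ j < m, P = E.canonPiece W (K + j)
  | 0, P, h => by simp [canonList] at h
  | m + 1, P, h => by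
    simp only [canonList, List.mem_cons] at h
    rcases h with h | h
    · exact ⟨m, Nat.lt_succ_self m, h⟩
    · obtain ⟨j, hj, hP⟩ := mem_canonList h
      exact ⟨j, Nat.lt_succ_of_lt hj, hP⟩

/-- The chain: `canonList W K m` covers `[W/(K+m), t)` whenever `t·K = W`… precisely, started at any `s ≥ W/(K+m)` it
chains down to `t = W/K`. -/
theorem canonList_chain {W K : ℕ} (hK : 0 < K) {t : ℚ} (ht : t * K = W) :
    ∀ (m : ℕ) (s : ℚ), (W : ℚ) / ((K + m : ℕ) : ℚ) ≤ s → PhiCert.chainOK s (E.canonList W K m) t = true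
  | 0, s, hs => by
    simp only [canonList, PhiCert.chainOK, decide_eq_true_eq]
    have hK' : (0 : ℚ) < K := by exact_mod_cast hK
    rw [Nat.add_zero, div_le_iff₀ hK'] at hs
    nlinarith
  | m + 1, s, hs => by
    simp only [canonList, PhiCert.chainOK, Bool.and_eq_true, decide_eq_true_eq]
    refine ⟨?_, canonList_chain hK ht m _ (le_of_eq ?_)⟩
    · show (PhiPiece.canon W (K + m) (E.canonC W (K + m)) (E.canonG W (K + m))).a ≤ s
      rw [PhiPiece.canon_a]
      exact hs
    · show (W : ℚ) / ((K + m : ℕ) : ℚ) = (PhiPiece.canon W (K + m) (E.canonC W (K + m)) (E.canonG W (K + m))).b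
      rw [PhiPiece.canon_b]

/-- **THE CANONICAL CERTIFICATE PASSES THE CHECKER** — for every direction and every `K, N₀ ≥ 1` (structural; no
per-direction computation). -/
theorem canon_certCheck (K N₀ : ℕ) (hK : 0 < K) (hN : 0 < N₀) : E.certCheck (E.canonCert K N₀) = true := by
  have hW : 0 < K * N₀ := Nat.mul_pos hK hN
  have hμ : 0 < E.imu E.d := E.imu_pos _
  have hKle : K ≤ K * N₀ * E.imu E.d := by
    calc K = K * 1 * 1 := by ring
      _ ≤ K * N₀ * E.imu E.d := Nat.mul_le_mul (Nat.mul_le_mul_left K hN) hμ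
  unfold certCheck
  simp only [canonCert, Bool.and_eq_true, decide_eq_true_eq, List.all_eq_true]
  refine ⟨⟨⟨hN, hW⟩, fun P hP => ?_⟩, ?_⟩
  · obtain ⟨j, -, rfl⟩ := E.mem_canonList hP
    exact E.canonPiece_check hW (by omega)
  · refine E.canonList_chain hK (t := ((N₀ : ℕ) : ℚ)) (by push_cast; ring) _ _ (le_of_eq ?_)
    rw [Nat.add_sub_cancel' hKle]
    have hW' : ((K * N₀ : ℕ) : ℚ) ≠ 0 := by exact_mod_cast hW.ne'
    have hμ' : ((E.imu E.d : ℕ) : ℚ) ≠ 0 := by exact_mod_cast hμ.ne'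
    rw [Nat.cast_mul (K * N₀)]
    field_simp

/-- `φ̄` of the canonical certificate: `(M+8)/N₀ + canonSub/(K N₀)`. -/
theorem phiBar_canon (K N₀ : ℕ) :
    E.phiBar (E.canonCert K N₀) = ((M + 8 : ℕ) : ℝ) / N₀ + (E.canonSub K N₀ : ℝ) / ((K * N₀ : ℕ) : ℝ) := rfl

/-! ### 3. The `Φ`-rate and the interior no-go at EVERY direction -/

/-- **THE `Φ`-RATE (8.10) AT EVERY INTEGRAL DIRECTION, IN THE KERNEL**: for all `K, N₀ ≥ 1` and `ε > 0`, eventually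
`log Φ(h_n) ≤ ((M+8)/N₀ + canonSub/(K N₀) + ε)·n`. -/
theorem log_intPhi_eventually_le_canon (K N₀ : ℕ) (hK : 0 < K) (hN : 0 < N₀) {ε : ℝ} (hε : 0 < ε) :
    ∀ᶠ n : ℕ in atTop, Real.log (E.intPhi n)
      ≤ (((M + 8 : ℕ) : ℝ) / N₀ + (E.canonSub K N₀ : ℝ) / ((K * N₀ : ℕ) : ℝ) + ε) * n := by
  rw [← phiBar_canon]
  exact E.log_intPhi_eventually_le (E.canon_certCheck K N₀ hK hN) hε

/-- **THE INTERIOR NO-GO AT EVERY INTEGRAL DIRECTION, `Φ`-RATE DISCHARGED.**  For every `E : IntDir M`, all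
`K, N₀ ≥ 1` and every `C₀` with `C₀ + (M+8)/N₀ + canonSub E K N₀/(K N₀) < δ`: IF `(i)` for every `C > C₀`,
`|F(h_n)| ≥ e^{−Cn}` infinitely often ([Zudilin2004, Lemma 20] — the ONLY remaining hypothesis), THEN
`Λ_n = D(n)Φ(h_n)⁻¹F(h_n) ↛ 0`: Nesterenko's criterion / Proposition 5 cannot be fed from this direction. -/
theorem interior_noGo_canon (K N₀ : ℕ) (hK : 0 < K) (hN : 0 < N₀) (C0 : ℝ)
    (hκ : C0 + (((M + 8 : ℕ) : ℝ) / N₀ + (E.canonSub K N₀ : ℝ) / ((K * N₀ : ℕ) : ℝ)) < E.intDelta)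
    (hL20 : ∀ C : ℝ, C0 < C → ∃ᶠ n : ℕ in atTop, Real.exp (-(C * n)) ≤ |E.intF n|) :
    ¬ Tendsto E.intLambda atTop (𝓝 0) :=
  E.interior_noGo_cert (E.canon_certCheck K N₀ hK hN) C0 (by rw [phiBar_canon]; exact hκ) hL20

/-- Growth form: for any `ε < δ − C₀ − (M+8)/N₀ − canonSub/(K N₀)`, `|Λ_n| ≥ e^{εn}` infinitely often. -/
theorem interior_frequently_exp_le_canon (K N₀ : ℕ) (hK : 0 < K) (hN : 0 < N₀) (C0 : ℝ) {ε : ℝ}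
    (hε : ε < E.intDelta - C0 - (((M + 8 : ℕ) : ℝ) / N₀ + (E.canonSub K N₀ : ℝ) / ((K * N₀ : ℕ) : ℝ)))
    (hL20 : ∀ C : ℝ, C0 < C → ∃ᶠ n : ℕ in atTop, Real.exp (-(C * n)) ≤ |E.intF n|) :
    ∃ᶠ n : ℕ in atTop, Real.exp (ε * n) ≤ |E.intLambda n| :=
  E.interior_frequently_exp_le_cert (E.canon_certCheck K N₀ hK hN) C0 (by rw [phiBar_canon]; exact hε) hL20

end IntDir

end WellPoisedFace

/-! ### 4. `q = 7` (`ζ(5)`-only box, class `vwp`): the dictionary to `genPhi / genF / genLambda / genDelta` -/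

namespace WellPoisedInterior

open WellPoisedFace WellPoisedFace.IntDir WellPoisedFaceRate

/-- An admissible `q = 7` direction `(η₀; η₁,η₂,η₃ | η₄,η₅,η₆,η₇)` [(8.13): heads `≤ η₄ ≤ η_j ≤ η₇ < η₀/2`] as an
`IntDir 2`. -/
def dir7 (η₀ : ℕ) (ηp : Fin 3 → ℕ) (ηb : Fin 4 → ℕ) (hpb : ∀ i, ηp i ≤ ηb 0) (hlo : ∀ j, ηb 0 ≤ ηb j)
    (hhi : ∀ j, ηb j ≤ ηb 3) (hd : 2 * ηb 3 < η₀) : IntDir 2 :=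
  ⟨⟨η₀, ηb, hlo, hhi, hd⟩, ηp, hpb⟩

/-- **THE `Φ`-RATE AT EVERY ADMISSIBLE `q = 7` DIRECTION** (eight-argument `genPhi` of `WellPoisedInteriorForms`):
for every `φ' > 10/N₀ + canonSub/(K N₀)`, eventually `log Φ(h_n) ≤ φ' n` — hypothesis `hPhiRate` of
`WellPoisedInterior.interior_noGo`, discharged. -/
theorem canon_phiRate7 (η₀ : ℕ) (ηp : Fin 3 → ℕ) (ηb : Fin 4 → ℕ) (hpb : ∀ i, ηp i ≤ ηb 0)
    (hlo : ∀ j, ηb 0 ≤ ηb j) (hhi : ∀ j, ηb j ≤ ηb 3) (hd : 2 * ηb 3 < η₀) (K N₀ : ℕ) (hK : 0 < K) (hN : 0 < N₀)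
    (φ' : ℝ) (hφ' : (10 : ℝ) / N₀ + ((dir7 η₀ ηp ηb hpb hlo hhi hd).canonSub K N₀ : ℝ) / ((K * N₀ : ℕ) : ℝ) < φ') :
    ∀ᶠ n : ℕ in atTop, Real.log (genPhi η₀ ηp ηb n) ≤ φ' * n := by
  set E := dir7 η₀ ηp ηb hpb hlo hhi hd with hE
  -- dictionary: the generic `intPhi` (`PhiQ`, tails as a vector) IS the eight-argument `genPhi` (`PhiQ_four`)
  have hdict : ∀ n, E.intPhi n = genPhi η₀ ηp ηb n := fun n => by
    have hT : ![hZ ηb n 0, hZ ηb n 1, hZ ηb n 2, hZ ηb n 3] = E.hT n := by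
      funext j
      fin_cases j <;> rfl
    rw [genPhi, ← PhiQ_four, hT]
    rfl
  have h := E.log_intPhi_eventually_le_canon K N₀ hK hN
    (ε := φ' - ((10 : ℝ) / N₀ + (E.canonSub K N₀ : ℝ) / ((K * N₀ : ℕ) : ℝ))) (by linarith)
  refine h.mono fun n hn => ?_
  have e : ((((2 + 8 : ℕ) : ℝ) / N₀ + (E.canonSub K N₀ : ℝ) / ((K * N₀ : ℕ) : ℝ))
      + (φ' - ((10 : ℝ) / N₀ + (E.canonSub K N₀ : ℝ) / ((K * N₀ : ℕ) : ℝ)))) * (n : ℝ) = φ' * n := by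
    norm_num
  rwa [e, hdict] at hn

/-- **THE INTERIOR NO-GO AT EVERY ADMISSIBLE `q = 7` DIRECTION, `Φ`-RATE DISCHARGED** (class `vwp`, the whole
`ζ(5)`-only box at once).  For all `K, N₀ ≥ 1` and every `C₀ < genDelta − 10/N₀ − canonSub/(K N₀)`: IF for every
`C > C₀`, `F(h_n) ≠ 0` and `log |F(h_n)| ≥ −Cn` infinitely often ([Zudilin2004, Lemma 20]: `lim sup (1/n) log |F(h_n)|
= −C₀` in the interior `η₁ ≥ 1` — PRINTED, the only hypothesis left), THEN the Lemma-19-normalised forms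
`Λ_n = D_{M₁}³D_{M₂}D_{M₃}D_{M₄} Φ(h_n)⁻¹ F(h_n)` do not tend to `0`. -/
theorem interior_noGo_canon7 (η₀ : ℕ) (ηp : Fin 3 → ℕ) (ηb : Fin 4 → ℕ) (hpb : ∀ i, ηp i ≤ ηb 0)
    (hlo : ∀ j, ηb 0 ≤ ηb j) (hhi : ∀ j, ηb j ≤ ηb 3) (hd : 2 * ηb 3 < η₀) (K N₀ : ℕ) (hK : 0 < K) (hN : 0 < N₀)
    (C0 : ℝ) (hκ : C0 + ((10 : ℝ) / N₀ + ((dir7 η₀ ηp ηb hpb hlo hhi hd).canonSub K N₀ : ℝ) / ((K * N₀ : ℕ) : ℝ))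
      < (genDelta η₀ ηp ηb : ℝ))
    (hL20 : ∀ C : ℝ, C0 < C →
      ∃ᶠ n : ℕ in atTop, genF η₀ ηp ηb n ≠ 0 ∧ -(C * n) ≤ Real.log |genF η₀ ηp ηb n|) :
    ¬ Tendsto (genLambda η₀ ηp ηb) atTop (𝓝 0) :=
  have hb : ∀ j, 2 * ηb j < η₀ := fun j => by have := hhi j; omega
  interior_noGo η₀ ηp ηb hpb hb C0 _ hκ hL20 (canon_phiRate7 η₀ ηp ηb hpb hlo hhi hd K N₀ hK hN)

/-! ### 5. Kernel cross-checks of the functional at the two `κ`-arg-max directions of the lane record -/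

/-- `canonSub (30; 1,1,1 | 8,9,10,11) 8 2 = 431` — the PRODUCTION parameters `(K, N₀) = (8, 2)` of the g83 box table
at the record direction (280 pieces; kernel, ≈ 1 min): `φ̄ = 10/2 + 431/16 = 511/16`, the value both exact mirrors
print. -/
theorem canonSub_30_8_2 :
    (dir7 30 ![1, 1, 1] ![8, 9, 10, 11] (by decide) (by decide) (by decide) (by decide)).canonSub 8 2 = 431 := by
  decide +kernel

/-- `canonSub (24; 1,1,1 | 6,7,8,9) 1 1 = 78` (13 pieces; kernel) — a second direction, coarsest parameters. -/
theorem canonSub_24_1_1 :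
    (dir7 24 ![1, 1, 1] ![6, 7, 8, 9] (by decide) (by decide) (by decide) (by decide)).canonSub 1 1 = 78 := by
  decide +kernel

end WellPoisedInterior

end Summit.KontsevichZagierPeriods.Zeta5Search

end
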